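import Summits.FinalStateConjecture.FinalStateConjecture.Theorems.StarvedNecksHonestFixedRadiusSettlingStubFarExitChart
import Summits.FinalStateConjecture.FinalStateConjecture.Theorems.StarvedNecksNecksCertifyStubSeamFlatRestrict
import Summits.FinalStateConjecture.FinalStateConjecture.Theorems.PhaseMixingCaptureWeakCosmicCensorshipMGHDStubScriTransfer
import Summits.FinalStateConjecture.FinalStateConjecture.Theorems.StarvedNecksHonestFixedRadiusSettlingStubFarExitEscape
import Literature.Geometry.Lorentzian.OpensChartGeodesicODE
import Literature.Geometry.Lorentzian.GeodesicSpeed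

/-!
# Crux `HonestFixedRadiusSettling` · line `sojourn-needs-only-one-over-delta` · stub `stub_farExit`
# Layer H2 (b): transport of maximal geodesics into a chart with nondegenerate pulled-back metric

Helper file for `stmt-FinalStateConjecture-13550` (stub `stub_farExit`). For a smooth chart map
`Φ : U → M` on an open `U ⊆ E4` into a spacetime `(M, g)` we consider the CHART COMPONENTS
`G♭ y = (Φ^* g)_y = (deviation from η, extended by 0) + η` (`Spacetime.deviationExtend`; a genuine
function `E4 → (E4 →L E4 →L ℝ)`, smooth on `U`, symmetric everywhere) and the open set
`W = {y ∈ U | G♭ y nondegenerate}` on which `Φ` is an equidimensional immersion, so that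
`(W, Φ^* g)` is a pseudo-Riemannian manifold (`PseudoRiemannianMetric.comap`) locally isometric to
`(M, g)` along `Φ`.

* `transport` — **the transport package.** A maximal `g`-geodesic `γ` with `γ 0 = Φ y₀`, `y₀ ∈ W`,
  `γ' 0 = dΦ w₀` is, on a sub-interval `dom' ∋ 0` of its domain, the image `Φ ∘ z` of a curve
  `z : dom' → W` (the maximal `Φ^* g`-geodesic with data `(y₀, w₀)`,
  `exists_isMaximalGeodesicOn_lift`), and in terms of the `E4`-valued `z`, `ż`: `γ = Φ ∘ z`,
  `γ' = dΦ(ż)`, `ż = dz/dt`, the momentum equations `d/dt G♭(z)(ż, v) = ½ ∂_v G♭(z)(ż, ż)`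
  (`OpensChart.hasDerivAt_momentum_of_isGeodesicOn`), conservation of `G♭(z)(ż, ż)`, and the
  ESCAPE ALTERNATIVE: if `dom'` is bounded above, the pairs `(z t, ż t)` cannot stay, for all late
  `t`, in `K × B̄(0, V)` for a compact `K ⊆ W` (`not_bddAbove_of_tangentLift_mem`).

References: B. O'Neill, *Semi-Riemannian geometry* (1983), Ch. 3, Prop. 3.24, Cor. 3.21 and
pp. 90–91; J. M. Lee, *Introduction to Riemannian Manifolds* (2018), Lemma 6.19.
-/

set_option linter.dupNamespace false

noncomputable section

open Literature.Geometry.Lorentzian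
open scoped Manifold ContDiff Topology
open Bundle Filter Set Function TopologicalSpace

namespace Summit.FinalStateConjecture.FinalStateConjecture.Theorems.StarvedNecks.OneOverDelta.Transport

open Summit.FinalStateConjecture.FinalStateConjecture.Theorems
open Summit.FinalStateConjecture.FinalStateConjecture.Theorems.PhaseMixingCapture.WeakCosmicCensorshipMGHD
open Summit.FinalStateConjecture.FinalStateConjecture.Theorems.StarvedNecks.OneOverDelta.Escape

/-! ## The transport package -/

section TransportPackage

variable {𝓢 : Spacetime 4} {U : Opens E4} {Φ : U → 𝓢.carrier}
  {Gc : E4 → E4 →L[ℝ] E4 →L[ℝ] ℝ}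

/-- **The transport package** (module docstring). [cite: ONeill1983, Ch. 3, Prop. 3.24 and pp. 90–91] -/
theorem transport [𝓢.metric.HasLeviCivita] (hΦ : ContMDiff 𝓘(ℝ, E4) (𝓡 4) ∞ Φ)
    (hGc : Gc = fun y ↦ 𝓢.deviationExtend (Minkowski.backgroundOn U) Φ y + Minkowski.bilin)
    {γ : ℝ → 𝓢.carrier} {dom : Set ℝ} (hγ : IsMaximalGeodesicOn 𝓢.metric.leviCivita γ dom)
    (h0 : (0 : ℝ) ∈ dom) {y₀ : E4} (hy₀U : y₀ ∈ U)
    (hy₀ : Gc y₀ ∈ range ((↑) : (E4 ≃L[ℝ] (E4 →L[ℝ] ℝ)) → E4 →L[ℝ] (E4 →L[ℝ] ℝ)))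
    (hγ0 : γ 0 = Φ ⟨y₀, hy₀U⟩) {w₀ : E4}
    (hw₀ : mfderiv 𝓘(ℝ, E4) (𝓡 4) Φ ⟨y₀, hy₀U⟩ w₀ = velocity (𝓡 4) γ 0) :
    ∃ (z ż : ℝ → E4) (dom' : Set ℝ), IsOpen dom' ∧ dom'.OrdConnected ∧ (0 : ℝ) ∈ dom' ∧ dom' ⊆ dom ∧
      z 0 = y₀ ∧ ż 0 = w₀ ∧
      (∀ t ∈ dom', z t ∈ (U : Set E4) ∧
        Gc (z t) ∈ range ((↑) : (E4 ≃L[ℝ] (E4 →L[ℝ] ℝ)) → E4 →L[ℝ] (E4 →L[ℝ] ℝ))) ∧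
      (∀ t ∈ dom', ∀ ht : z t ∈ U, γ t = Φ ⟨z t, ht⟩ ∧
        velocity (𝓡 4) γ t = mfderiv 𝓘(ℝ, E4) (𝓡 4) Φ ⟨z t, ht⟩ (ż t)) ∧
      (∀ t ∈ dom', HasDerivAt z (ż t) t) ∧
      (∀ t ∈ dom', ∀ v : E4, HasDerivAt (fun s ↦ Gc (z s) (ż s) v)
        ((2 : ℝ)⁻¹ * fderiv ℝ Gc (z t) v (ż t) (ż t)) t) ∧
      (∀ t ∈ dom', Gc (z t) (ż t) (ż t) = Gc y₀ w₀ w₀) ∧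
      (BddAbove dom' → ∀ K : Set E4, IsCompact K →
        K ⊆ (U : Set E4) ∩ Gc ⁻¹' range ((↑) : (E4 ≃L[ℝ] (E4 →L[ℝ] ℝ)) → E4 →L[ℝ] (E4 →L[ℝ] ℝ)) →
        ∀ (V t₁ : ℝ), t₁ ∈ dom' → (∀ t ∈ dom', t₁ ≤ t → z t ∈ K ∧ ‖ż t‖ ≤ V) → False) := by
  classical
  -- the nondegeneracy locus as an open submanifold of `E4`
  set Wset : Set E4 := (U : Set E4) ∩
    Gc ⁻¹' range ((↑) : (E4 ≃L[ℝ] (E4 →L[ℝ] ℝ)) → E4 →L[ℝ] (E4 →L[ℝ] ℝ)) with hWset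
  have hWopen : IsOpen Wset := isOpen_nondegLocus hGc hΦ
  set W : Opens E4 := ⟨Wset, hWopen⟩ with hW
  have hWU : W ≤ U := fun y hy ↦ hy.1
  set χ : W → 𝓢.carrier := Φ ∘ Opens.inclusion hWU with hχ_def
  have hχs : ContMDiff 𝓘(ℝ, E4) (𝓡 4) ∞ χ := hΦ.comp (contMDiff_inclusion hWU)
  have hχ : ContMDiff 𝓘(ℝ, E4) (𝓡 4) (∞ + 1) χ := by
    have h : ((∞ : ℕ∞ω) + 1) = ∞ := rfl
    rw [h]; exact hχs
  have hΦd : ∀ y : U, MDifferentiableAt 𝓘(ℝ, E4) (𝓡 4) Φ y := fun y ↦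
    (hΦ y).mdifferentiableAt (by simp)
  have hmf : ∀ y : W, mfderiv 𝓘(ℝ, E4) (𝓡 4) χ y = mfderiv 𝓘(ℝ, E4) (𝓡 4) Φ (Opens.inclusion hWU y) :=
    fun y ↦ NecksCertifyBargmann.FlatRestrict.mfderiv_comp_inclusion_eq hWU (hΦd _)
  -- nondegeneracy of the components on `W` gives injective differentials
  have hχ' : ∀ y : W, Injective (mfderiv 𝓘(ℝ, E4) (𝓡 4) χ y) := by
    intro y
    refine (injective_iff_map_eq_zero _).2 fun v hv ↦ nondegenerate_of_mem_range y.2.2 v fun w ↦ ?_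
    have hv' : mfderiv 𝓘(ℝ, E4) (𝓡 4) Φ (Opens.inclusion hWU y) v = 0 := by rw [← hmf]; exact hv
    rw [chartComponents_apply hGc (Opens.inclusion hWU y), hv', map_zero]
    rfl
  have hdim : Module.finrank ℝ E4 = Module.finrank ℝ (EuclideanSpace ℝ (Fin 4)) := rfl
  have hpb := PseudoRiemannianMetric.contMDiff_pullbackBilin_holds (I := 𝓡 4) (M := 𝓢.carrier)
    (I' := 𝓘(ℝ, E4)) (N := W) (n := (∞ : ℕ∞ω))
  set h := 𝓢.metric.toPseudoRiemannianMetric.comap hpb χ hχ hχ' hdim with hh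
  haveI : h.HasLeviCivita := h.hasLeviCivita
  have hval : ∀ (y : W) (v w : E4), h.val y v w = Gc y v w := by
    intro y v w
    rw [hh, PseudoRiemannianMetric.val_comap, pullbackBilin_apply, hmf,
      chartComponents_apply hGc (Opens.inclusion hWU y)]
    rfl
  have hG : ∀ y : W, h.val y = Gc y := fun y ↦
    ContinuousLinearMap.ext fun v ↦ ContinuousLinearMap.ext fun w ↦ hval y v w
  have hGd : ∀ y : W, DifferentiableAt ℝ Gc y := fun y ↦
    (contDiffAt_chartComponents hGc hΦ (Opens.inclusion hWU y)).differentiableAt (by simp)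
  -- the `C¹` connection instances
  have h2 : ((1 : ℕ∞) : ℕ∞ω) + 1 ≤ ∞ := by
    rw [show ((1 : ℕ∞) : ℕ∞ω) + 1 = 2 by norm_num]; exact WithTop.coe_le_coe.2 le_top
  haveI : CovariantDerivative.ContMDiffCovariantDerivative h.leviCivita 1 :=
    ⟨h.isLocallyContMDiff_leviCivita_holds 1 h2 univ isOpen_univ⟩
  -- lift the maximal geodesic
  set q : W := ⟨y₀, hy₀U, hy₀⟩ with hq
  have hq' : χ q = γ 0 := by rw [hγ0]; rfl
  have hw' : mfderiv 𝓘(ℝ, E4) (𝓡 4) χ q w₀ = velocity (𝓡 4) γ 0 := by rw [hmf]; exact hw₀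
  obtain ⟨zW, dom', hmax, h0', hzW0, hzWv, hsub, hcomp⟩ :=
    exists_isMaximalGeodesicOn_lift (g := 𝓢.metric.toPseudoRiemannianMetric) (g' := h) hχ hχ' hdim
      (fun _ ↦ rfl) hγ h0 hq' hw'
  set z : ℝ → E4 := fun t ↦ ((zW t : W) : E4) with hz
  set ż : ℝ → E4 := fun t ↦ (velocity 𝓘(ℝ, E4) zW t : E4) with hż
  -- the chart ODE
  have hode : ∀ t ∈ dom', HasDerivAt z (ż t) t ∧ HasDerivAt ż
      (-OpensChart.christoffel h Gc (zW t) (ż t) (ż t)) t :=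
    fun t ht ↦ OpensChart.hasDerivAt_of_isGeodesicOn hG hGd hmax.isGeodesicOn ht
  -- the image curve and its velocity
  obtain ⟨-, hcompv⟩ := Literature.Geometry.Riemannian.SimpleAH.isGeodesicOn_comp
    (hpb := hpb) (hf := hχ) (hf' := hχ') (hdim := hdim) hmax.isOpen hmax.isGeodesicOn
  refine ⟨z, ż, dom', hmax.isOpen, hmax.2.1, h0', hsub, by simp [hz, hzW0, hq], by simp [hż, hzWv],
    fun t _ ↦ (zW t).2, fun t ht htU ↦ ?_, fun t ht ↦ (hode t ht).1, fun t ht v ↦ ?_, fun t ht ↦ ?_,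
    fun hbdd K hK hKW V t₁ ht₁ hmem ↦ ?_⟩
  · -- `γ = Φ ∘ z`, `γ' = dΦ(ż)`
    have e1 : (⟨z t, htU⟩ : U) = Opens.inclusion hWU (zW t) := rfl
    refine ⟨by rw [e1]; exact (hcomp t ht).symm, ?_⟩
    have hev : γ =ᶠ[𝓝 t] fun s ↦ χ (zW s) :=
      Filter.eventuallyEq_of_mem (hmax.isOpen.mem_nhds ht) fun s hs ↦ (hcomp s hs).symm
    rw [velocity_congr_of_eventuallyEq hev.symm |>.symm, hcompv t ht, hmf, e1]
    rfl
  · -- momentum equations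
    exact OpensChart.hasDerivAt_momentum_of_isGeodesicOn hG hGd (chartComponents_symm hGc)
      hmax.isGeodesicOn ht v
  · -- conservation of `G♭(ż, ż)`
    have := h.val_velocity_eq_of_isGeodesicOn_holds hmax.isOpen hmax.2.1 hmax.isGeodesicOn ht h0'
    rw [hval, hval, hzW0, hzWv] at this
    exact this
  · -- the escape alternative
    have hKW' : K ⊆ (W : Set E4) := hKW
    have h𝒦 := isCompact_setOf_tangent (U := W) hK hKW' V
    exact not_bddAbove_of_tangentLift_mem hmax h𝒦 ht₁
      (fun t ht hle ↦ ⟨(hmem t ht hle).1, (hmem t ht hle).2⟩) hbdd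

/-- **Deciding theorem of this helper file (registered stub `farExit_transport_curve`)**: the
transport package trimmed to tree vocabulary — a maximal geodesic issuing from a chart point with
nondegenerate chart components is, near the start, the image of a chart curve with the prescribed
initial data. [cite: ONeill1983, Ch. 3, Prop. 3.24 and pp. 90–91] -/
theorem farExit_transport_curve : ∀ (𝓢 : Spacetime 4) (U : TopologicalSpace.Opens E4) (Φ : U → 𝓢.carrier) [𝓢.metric.HasLeviCivita], ContMDiff 𝓘(ℝ, E4) (𝓡 4) ∞ Φ → ∀ (γ : ℝ → 𝓢.carrier) (dom : Set ℝ), IsMaximalGeodesicOn 𝓢.metric.leviCivita γ dom → (0 : ℝ) ∈ dom → ∀ (y₀ w₀ : E4) (hy₀U : y₀ ∈ U), (∀ u : E4, (∀ v : E4, (𝓢.deviationExtend (Minkowski.backgroundOn U) Φ y₀ + Minkowski.bilin) u v = 0) → u = 0) → γ 0 = Φ ⟨y₀, hy₀U⟩ → mfderiv 𝓘(ℝ, E4) (𝓡 4) Φ ⟨y₀, hy₀U⟩ w₀ = velocity (𝓡 4) γ 0 → ∃ (z ż : ℝ → E4) (dom' : Set ℝ), IsOpen dom' ∧ (0 : ℝ)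 ∈ dom' ∧ dom' ⊆ dom ∧ z 0 = y₀ ∧ ż 0 = w₀ ∧ (∀ t ∈ dom', HasDerivAt z (ż t) t) ∧ ∀ t ∈ dom', ∀ ht : z t ∈ U, γ t = Φ ⟨z t, ht⟩ := by
  intro 𝓢 U Φ _ hΦ γ dom hγ h0 y₀ w₀ hy₀U hnd hγ0 hw₀
  obtain ⟨z, ż, dom', hdo, -, h0', hsub, hz0, hż0, -, hγz, hzd, -⟩ :=
    transport hΦ rfl hγ h0 hy₀U (mem_range_of_nondegenerate _ hnd) hγ0 hw₀
  exact ⟨z, ż, dom', hdo, h0', hsub, hz0, hż0, hzd, fun t ht htU ↦ (hγz t ht htU).1⟩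

end TransportPackage

end Summit.FinalStateConjecture.FinalStateConjecture.Theorems.StarvedNecks.OneOverDelta.Transport

end
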